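import Mathlib
import Summits.PneNP.PneNP.Statement
import Literature.Computability.Complexity.CookBridges
import Literature.Computability.Complexity.NegCNFTranscoder
import Literature.Computability.Complexity.ReductionsProofs
import Literature.Computability.Complexity.CookLevinSAT
import Literature.Computability.Complexity.NondeterministicProofs
import HarnessLib

/-!
# Anchor: the summit `PneNP` is literally `SAT ∉ P` in the prelude model

Solo seat `solo-PneNP-blind` (blind mode). Two kernel-checked anchors for the "what a proof must
do" document (`run/shared/lean/ideation/PneNP/solo-blind/PLAN.md`):

* `SoloBlind.pneNP_iff_P_ne_NP` — the root statement `PneNP` (Cook's `∃ L ∈ NP Bool, L ∉ P Bool`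
  over Mathlib `FinTM2`) is equivalent to `Classes.P ≠ Nondeterministic.NP` in the prelude's
  `{0,1}` model (re-export of the Literature bridge `pneNP_shape_iff_P_ne_NP`, CookBridges.lean);
* `SoloBlind.pneNP_iff_SAT_not_mem_P` — by the tree's Cook–Levin theorem
  (`SAT_isNPHard_holds`, `SAT_mem_NP_holds`) and closure of `P` under Karp reductions
  (`mem_P_of_karpReducible_holds`), `PneNP ↔ SAT ∉ Classes.P`: any proof of the summit is, up
  to a few lines of bookkeeping, a super-polynomial time lower bound for the single explicit
  language `SAT` (CNF satisfiability, `CNF.lean`) against every `FinTM2` decider.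

[cite: Cook1971, Thm 1] [cite: AroraBarakCC2009, Thm. 2.10, Lemma 2.11]
-/

namespace Summit.PneNP.PneNP.Theorems

open Literature.Computability.Complexity
open scoped Literature.Computability.Complexity.Notation

/-- The root statement `PneNP` is equivalent to `Classes.P ≠ Nondeterministic.NP`
(prelude `{0,1}` model; Literature bridge `pneNP_shape_iff_P_ne_NP`).
[cite: CookClay2006, §1] -/
theorem SoloBlind.pneNP_iff_P_ne_NP : PneNP ↔ Classes.P ≠ Nondeterministic.NP :=
  pneNP_shape_iff_P_ne_NP

/-- **`P ≠ NP` iff `SAT ∉ P`** (Cook–Levin). The summit `PneNP` holds iff the language `SAT` of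
satisfiable CNFs (`Literature.Computability.Complexity.SAT`) is decided by no polynomial-time
`FinTM2`. [cite: Cook1971, Thm 1] [cite: AroraBarakCC2009, Thm. 2.10] -/
theorem SoloBlind.pneNP_iff_SAT_not_mem_P : PneNP ↔ SAT ∉ Classes.P := by
  rw [SoloBlind.pneNP_iff_P_ne_NP]
  constructor
  · intro hne hSAT
    apply hne
    apply Set.Subset.antisymm
    · exact P_subset_NP_holds
    · intro L hL
      exact mem_P_of_karpReducible_holds (SAT_isNPHard_holds L hL) hSAT
  · intro hSAT heq
    apply hSAT
    rw [heq]
    exact SAT_mem_NP_holds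

/-- Contrapositive packaging used by the obstruction document: to prove the summit it suffices
(and is necessary) to show that every polynomial-time decider errs on `SAT`. -/
theorem SoloBlind.pneNP_of_SAT_not_mem_P (h : SAT ∉ Classes.P) : PneNP :=
  SoloBlind.pneNP_iff_SAT_not_mem_P.2 h

end Summit.PneNP.PneNP.Theorems
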